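import Mathlib
import HarnessLib
import Summits.Ventures.LatticeQCDFlow.Exactness.SphereSiteLaplacianCalculus

/-!
# Euler's identities and the site operator `∂̃·∂̃` on positively homogeneous sections: `Δ(q∘ν) = Δq − n(n+d−2)·q`

HONEST FRAMING: exact (Metropolis-corrected) sampling algorithms for lattice gauge theory;
figures of merit are autocorrelation/cost numbers at stated couplings and volumes; no
continuum-physics claim.

Venture `LatticeQCDFlow` (cell pub-lqcd), topic `Exactness`; FANOUT row 7 (`s0-cpn-null`).  NEW
WORK of the cell over Mathlib and the tree's `Exactness/SphereTangentialLaplacian.lean`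
(`laplacian_comp_normalize`: `Δ(f∘ν)(u) = Δf(u) − D²f(u)(u,u) − (d−1)Df(u)u` on the unit sphere)
and `Exactness/SphereSiteLaplacianCalculus.lean` (`siteLaplacian_eq_of_forall`); nothing is cited
as a fact.  Printed counterparts, NAMED ONLY: Euler's homogeneous-function theorem and the
solid-harmonics formula `Δ_S(q|_S) = (Δq)|_S − n(n+d−2)·q|_S` [folklore]; M. Lüscher, Commun.
Math. Phys. 293 (2010) 899, §4.4 ("`Δ` maps any polynomial … into another polynomial" — the
degree bookkeeping behind the order-by-order construction); the tree's Literature files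
`Analysis/Calculus/SphericalHarmonicEigen`, `MvPolynomialFDeriv` prove the same identities for
`MvPolynomial` functions on `ℝⁿ` — here for ANY positively homogeneous `C²` function on any `E`,
which is the form E–S's site sections take (a lattice monomial is, in each site variable, a
homogeneous polynomial times a factor frozen in the other sites).

## Content (`q : E → ℝ` positively homogeneous of degree `n`: `q(t•y) = tⁿ q(y)` for `t > 0`)

* **`fderiv_apply_self_of_posHomogeneous`** — EULER I: `Dq(u) u = n·q(u)` (`q` differentiable at `u`).
* `smul_fderiv_smul_of_posHomogeneous` — `t • Dq(t•z) = tⁿ • Dq(z)` (`t > 0`): the differential is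
  homogeneous of degree `n − 1`; `fderiv_apply_self_posHomogeneous` — `z ↦ Dq(z) z` is again
  positively homogeneous of degree `n`.
* **`fderiv_fderiv_apply_self_self_of_posHomogeneous`** — EULER II: `D²q(u)(u,u) = n(n−1)·q(u)`.
* **`laplacian_comp_normalize_of_posHomogeneous`** — for `‖u‖ = 1`:
  `Δ(q∘ν)(u) = Δq(u) − n(n + d − 2)·q(u)`, `d = dim E` (so a HARMONIC homogeneous `q` restricts
  to an eigenfunction of `−∂̃·∂̃` with eigenvalue `n(n+d−2)`: `n = 1`: `d−1`, `n = 2`: `2d`, the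
  cases of `SphereTangentialLaplacian` / `SphereSiteLaplacianCalculus`).
* **`siteLaplacian_of_posHomogeneous_section`** — E–S's site operator on a section
  `G(x_k ← y) = c·q(y)`: `∂̃_k·∂̃_k G(x) = c·(Δq(x_k) − n(n+d−2) q(x_k))` — the degree does not go
  up: the bookkeeping step of the polynomial closure of Lüscher's recursion for the E–S action.

NOT CLAIMED: the polynomial closure itself (a finite-dimensional `𝔏₀`-stable space containing the
action and all sources — the instance for `SphereLatticePoissonSolver`); anything quantitative.
-/

noncomputable section

namespace Summit.Ventures.LatticeQCDFlow.Exactness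

open NormedSpace Filter InnerProductSpace Laplacian
open scoped RealInnerProductSpace Topology

variable {E : Type*} [NormedAddCommGroup E] [InnerProductSpace ℝ E]

/-! ## §1 Euler's identities for positively homogeneous functions -/

section Euler

variable {q : E → ℝ} {n : ℕ}

/-- **Euler I**: `Dq(u) u = n·q(u)` for `q` positively homogeneous of degree `n` and
differentiable at `u`. -/
theorem fderiv_apply_self_of_posHomogeneous (hq : ∀ t : ℝ, 0 < t → ∀ y, q (t • y) = t ^ n * q y)
    {u : E} (hd : DifferentiableAt ℝ q u) : fderiv ℝ q u u = n * q u := by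
  -- `g(t) = q(t•u)` has derivative `Dq(u) u` at `t = 1` …
  have hs : HasDerivAt (fun t : ℝ => t • u) u 1 := by
    simpa using (hasDerivAt_id (1 : ℝ)).smul_const u
  have hd' : HasFDerivAt q (fderiv ℝ q u) ((fun t : ℝ => t • u) 1) := by
    simp only [one_smul]; exact hd.hasFDerivAt
  have h1 : HasDerivAt (fun t : ℝ => q (t • u)) (fderiv ℝ q u u) 1 := hd'.comp_hasDerivAt (1 : ℝ) hs
  -- … and equals `tⁿ q(u)` near `t = 1`
  have h2 : HasDerivAt (fun t : ℝ => t ^ n * q u) ((n : ℝ) * 1 ^ (n - 1) * q u) 1 :=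
    (hasDerivAt_pow n (1 : ℝ)).mul_const _
  have heq : (fun t : ℝ => t ^ n * q u) =ᶠ[𝓝 1] fun t => q (t • u) := by
    filter_upwards [lt_mem_nhds (zero_lt_one' ℝ)] with t ht using (hq t ht u).symm
  have h3 := (h2.congr_of_eventuallyEq heq.symm)
  have := h1.unique h3
  rw [this, one_pow, mul_one]

/-- **The differential is homogeneous of degree `n − 1`**: `t • Dq(t•z) = tⁿ • Dq(z)` for `t > 0`,
`q` differentiable at `z` and at `t•z`. -/
theorem smul_fderiv_smul_of_posHomogeneous (hq : ∀ t : ℝ, 0 < t → ∀ y, q (t • y) = t ^ n * q y)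
    {t : ℝ} (ht : 0 < t) {z : E} (hz : DifferentiableAt ℝ q z) (htz : DifferentiableAt ℝ q (t • z)) :
    t • fderiv ℝ q (t • z) = t ^ n • fderiv ℝ q z := by
  -- two derivatives of `y ↦ q(t•y)` at `z`
  have hA : HasFDerivAt (fun y : E => q (t • y))
      ((fderiv ℝ q (t • z)).comp (t • ContinuousLinearMap.id ℝ E)) z := by
    have hl : HasFDerivAt (fun y : E => (t • ContinuousLinearMap.id ℝ E) y)
        (t • ContinuousLinearMap.id ℝ E) z := (t • ContinuousLinearMap.id ℝ E).hasFDerivAt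
    have hq' : HasFDerivAt q (fderiv ℝ q (t • z)) ((t • ContinuousLinearMap.id ℝ E) z) := by
      simpa using htz.hasFDerivAt
    exact hq'.comp z hl
  have hB : HasFDerivAt (fun y : E => q (t • y)) (t ^ n • fderiv ℝ q z) z := by
    have hfun : (fun y : E => q (t • y)) = fun y => t ^ n * q y := funext fun y => hq t ht y
    rw [hfun]
    exact hz.hasFDerivAt.const_mul (t ^ n)
  have h := hA.unique hB
  rw [ContinuousLinearMap.comp_smul, ContinuousLinearMap.comp_id] at h
  exact h

/-- **`z ↦ Dq(z) z` is positively homogeneous of degree `n`** (for `q` differentiable off the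
origin; at the origin both sides vanish). -/
theorem fderiv_apply_self_posHomogeneous (hq : ∀ t : ℝ, 0 < t → ∀ y, q (t • y) = t ^ n * q y)
    (hd : ∀ y : E, y ≠ 0 → DifferentiableAt ℝ q y) (t : ℝ) (ht : 0 < t) (z : E) :
    fderiv ℝ q (t • z) (t • z) = t ^ n * fderiv ℝ q z z := by
  by_cases hz : z = 0
  · subst hz; simp
  · have htz : t • z ≠ 0 := smul_ne_zero ht.ne' hz
    have h := smul_fderiv_smul_of_posHomogeneous hq ht (hd z hz) (hd _ htz)
    have h' := congrArg (fun L : E →L[ℝ] ℝ => L z) h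
    simp only [smul_apply, smul_eq_mul] at h'
    rw [map_smul, smul_eq_mul, h']

/-- **Euler II**: `D²q(u)(u,u) = n(n−1)·q(u)` for `q` positively homogeneous of degree `n`,
differentiable off the origin, with `Dq` differentiable at `u ≠ 0` (differentiate `z ↦ Dq(z) z`,
which is homogeneous of degree `n`, along `u`, and use Euler I twice). -/
theorem fderiv_fderiv_apply_self_self_of_posHomogeneous
    (hq : ∀ t : ℝ, 0 < t → ∀ y, q (t • y) = t ^ n * q y)
    (hd : ∀ y : E, y ≠ 0 → DifferentiableAt ℝ q y) {u : E} (hu : u ≠ 0)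
    (h2 : DifferentiableAt ℝ (fderiv ℝ q) u) :
    fderiv ℝ (fderiv ℝ q) u u u = n * (n - 1) * q u := by
  -- `φ(z) = Dq(z) z` is homogeneous of degree `n` and differentiable at `u`
  have hφ : ∀ t : ℝ, 0 < t → ∀ y : E,
      (fun z => fderiv ℝ q z z) (t • y) = t ^ n * (fun z => fderiv ℝ q z z) y :=
    fun t ht y => fderiv_apply_self_posHomogeneous hq hd t ht y
  have hφd : DifferentiableAt ℝ (fun z => fderiv ℝ q z z) u := h2.clm_apply differentiableAt_id
  have hE := fderiv_apply_self_of_posHomogeneous hφ hφd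
  -- `Dφ(u) u = D²q(u)(u,u) + Dq(u) u`
  have h1 : fderiv ℝ (fun z => fderiv ℝ q z z) u u = fderiv ℝ (fderiv ℝ q) u u u + fderiv ℝ q u u := by
    rw [fderiv_clm_apply (u := fun z => z) h2 differentiableAt_id]
    simp [add_comm]
  rw [h1, fderiv_apply_self_of_posHomogeneous hq (hd u hu)] at hE
  -- `D²q(u)(u,u) + n q = n (n q)`
  have : fderiv ℝ (fderiv ℝ q) u u u = n * (n * q u) - n * q u := by linarith
  rw [this]; ring

end Euler

/-! ## §2 The spherical Laplacian of a homogeneous function; E–S's site operator on homogeneous sections -/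

section Sphere

variable [FiniteDimensional ℝ E] {q : E → ℝ} {n : ℕ}

/-- **`Δ(q∘ν)(u) = Δq(u) − n(n + d − 2)·q(u)`** on the unit sphere (`‖u‖ = 1`), for `q`
positively homogeneous of degree `n`, of class `C²` at `u` and differentiable off the origin
(`d = dim E`): the solid-harmonics formula — a harmonic homogeneous `q` restricts to an
eigenfunction of `−∂̃·∂̃` with eigenvalue `n(n + d − 2)`. -/
theorem laplacian_comp_normalize_of_posHomogeneous
    (hq : ∀ t : ℝ, 0 < t → ∀ y, q (t • y) = t ^ n * q y)
    (hd : ∀ y : E, y ≠ 0 → DifferentiableAt ℝ q y) {u : E} (hu : ‖u‖ = 1)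
    (h2 : ContDiffAt ℝ 2 q u) :
    Δ (fun z => q (normalize z)) u =
      Δ q u - (n : ℝ) * (n + Module.finrank ℝ E - 2) * q u := by
  have hu0 : u ≠ 0 := by rintro rfl; simp at hu
  have hD : DifferentiableAt ℝ (fderiv ℝ q) u :=
    (h2.fderiv_right (m := 1) (by norm_num)).differentiableAt (by norm_num)
  rw [laplacian_comp_normalize hu h2, fderiv_fderiv_apply_self_self_of_posHomogeneous hq hd hu0 hD,
    fderiv_apply_self_of_posHomogeneous hq (hd u hu0)]
  ring

variable {Λ : Type*} [DecidableEq Λ]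

/-- **E–S's site operator on a homogeneous section.**  If, in the site variable `x_k`, `G` is a
frozen factor times a positively homogeneous `C²` function of degree `n`
(`G(x_k ← y) = c·q(y)`), then on the product of unit spheres
`∂̃_k·∂̃_k G(x) = c·(Δq(x_k) − n(n + d − 2)·q(x_k))` — in particular the "degree" does not go up
(Lüscher §4.4's bookkeeping, here for the sphere model). -/
theorem siteLaplacian_of_posHomogeneous_section {G : (Λ → E) → ℝ} {x : Λ → E} {k : Λ}
    (hx : ‖x k‖ = 1) {c : ℝ} (hq : ∀ t : ℝ, 0 < t → ∀ y, q (t • y) = t ^ n * q y)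
    (hqs : ContDiff ℝ 2 q) (h : ∀ y, G (Function.update x k y) = c * q y) :
    siteLaplacian k G x =
      c * (Δ q (x k) - (n : ℝ) * (n + Module.finrank ℝ E - 2) * q (x k)) := by
  have hd : ∀ y : E, y ≠ 0 → DifferentiableAt ℝ q y :=
    fun y _ => hqs.differentiable (by norm_num) y
  rw [siteLaplacian_eq_of_forall h]
  -- `Δ((c·q)∘ν) = c·Δ(q∘ν)`
  have hx0 : x k ≠ 0 := by intro h0; rw [h0, norm_zero] at hx; exact zero_ne_one hx
  have hq2 : ContDiffAt ℝ 2 (fun w : E => q (normalize w)) (x k) :=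
    (hqs.contDiffAt (x := normalize (x k))).comp (x k) (contDiffAt_normalize hx0)
  have hsm := laplacian_smul c hq2
  simp only [smul_eq_mul] at hsm
  have hfun : (fun z : E => c * q (normalize z)) = c • fun w : E => q (normalize w) := by
    funext z; simp only [Pi.smul_apply, smul_eq_mul]
  rw [hfun, hsm, laplacian_comp_normalize_of_posHomogeneous hq hd hx hqs.contDiffAt]

/-- **Sanity check, degree `1`**: a linear section `G(x_k ← y) = ⟪w, y⟫` has
`∂̃_k·∂̃_k G = −(d−1)⟪w, x_k⟫` (the eigenvalue of `SphereTangentialLaplacian`, recovered from the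
general formula with `n = 1`, `Δ⟪w,·⟫ = 0`). -/
theorem siteLaplacian_of_linear_section' {G : (Λ → E) → ℝ} {x : Λ → E} {k : Λ} (hx : ‖x k‖ = 1)
    {w : E} (h : ∀ y, G (Function.update x k y) = ⟪w, y⟫) :
    siteLaplacian k G x = -(((Module.finrank ℝ E : ℝ) - 1) * ⟪w, x k⟫) := by
  have hq : ∀ t : ℝ, 0 < t → ∀ y : E, ⟪w, t • y⟫ = t ^ 1 * ⟪w, y⟫ := fun t _ y => by
    rw [inner_smul_right, pow_one]
  have hqs : ContDiff ℝ 2 (fun y : E => ⟪w, y⟫) := contDiff_const.inner ℝ contDiff_id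
  have h' : ∀ y, G (Function.update x k y) = 1 * (fun y : E => ⟪w, y⟫) y := fun y => by
    rw [h y, one_mul]
  rw [siteLaplacian_of_posHomogeneous_section hx hq hqs h']
  have hΔ : Δ (fun y : E => ⟪w, y⟫) (x k) = 0 := by
    have := laplacian_inner_add_const w 0 (x k)
    simpa using this
  rw [hΔ]
  push_cast
  ring

end Sphere

end Summit.Ventures.LatticeQCDFlow.Exactness

end
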